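import Summits.QuantumFields.BalabanUV.Beta.SymCorrectorW2Gauge
import Summits.QuantumFields.BalabanUV.Beta.SpineRecursiveParity
import Summits.QuantumFields.BalabanUV.Beta.KernelWardRelative

/-!
# `BalabanUV.Beta.SymCorrectorMixedSiteNull` — road «BF-x», binder row D1, slot (K) ∕ junction (J1), brick TT21: **THE PARITY BOOKKEEPING OF THE SITE-LAW
# MIXED WORD** — against a spread sgn-symmetric kernel `G` and for row-parity-ODD multiplier tables `M`: the ANTICOMMUTATOR of a diagonal kernel with a
# parity-odd localised kernel is tadpole-null, so the LEFT word `−Θ′∘V_M` of TT19∕TT20 equals HALF the commutator `½·conjV V_M Θ′` under the tadpole; the ANCHOR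
# word `mixOfK K n A` (block-local rescaled multiplier tables) is localised (`LocStencilFM`) and tadpole-null; hence the displayed mixed word `WMs` of TT20 is,
# under the tadpole, HALF of TT13's commutator word at scalar `ξ′` (leaf-03 g31 N-g31-1 (2); at the record `½ξ′ = ξ`).

HONEST DEPENDENCY (cell records, verbatim): «continuum YM on T⁴ ⇐ BetaPertH ∧ nine spine estimates (0/9 proved); BetaPertH ⇐ (D1) ∧ (D4) ∧
CAP+tail; G-an2-4 gates asym, D1 and NE2/3/4.»  HONEST FRAMING (cell contract, verbatim): «discharging `BetaPertH` makes Bałaban's UV stability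
UNCONDITIONAL — a real constructive-QFT result; it is NOT the continuum limit and NOT the Clay problem.»  THIS MODULE is [folklore] parity ∕ trace
bookkeeping BY NAME over an1∕leaf-05's `KernelWardRelativeEnd.tadpole_eq_zero_of_parity`, leaf-05's `SecondOrderRemainderTables.tadpole_mixOfK_eq_zero ∕
trK_vertexOfM_eq_neg_sgnK_of_rows`, an2's `BorderedHessian` (`sgnK`, `comp_sgnK`, `diagK`), `TameKernelCalculus` (`trK_comp`, `tadpole_add`), lit-balaban's
`SecondOrderResponse.vertexFamily_vertexOfM`, `AxialDressing.l1_sub_le_of_blk_eq`, TT14's `loc_faceGen`; the sgn-symmetry of `G`, the row parities of `M` and the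
localisations are HYPOTHESES; the instance is NOT claimed; no definition, no `def … : Prop`, nothing cited, NO printed hypothesis, 0 sorry.  0∕4 row-D1 binders;
(J1) ONE OPEN ROW; (K) NOT closed; NOT D1, NEVER «G-an2-4 closed», NOT `BetaPertH`, NOT continuum, NOT Clay.

ABSOLUTE RULE (cell charter, verbatim): «No internally-minted statement may enter as a cited fact. Every hypothesis is either kernel-proved in
this package or a verbatim quotation of a PUBLISHED theorem with page reference. The manuscript(s) under audit are NOT citable for their own
disputed steps — they are the thing under adjudication; programme-internal (2001/route/tribunal) claims are never citable.»

Unit `b2b-balaban-beta-d1-formalise-leaf-03` (gen 31), D1 formalisation swarm LEAF PROVER 03 (the (J1) chart-transport lineage), 2026-08-23.  Not in print; our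
bookkeeping.  No existing file touched.
-/

noncomputable section

namespace Summit.QuantumFields.BalabanUV.Beta.SymCorrectorMixedSiteNull

open Finset
open scoped BigOperators
open Literature.MathematicalPhysics.QuantumFieldTheory
open Literature.MathematicalPhysics.QuantumFieldTheory.Balaban1983to89
open Literature.MathematicalPhysics.QuantumFieldTheory.Balaban1983to89.Beta
open B12Sec2to5 (l1 l1_nonneg)
open ExpKernelCalculus (MKer Decays BiLoc VertexFamily comp tadpole l1_sub_triangle l1_sub_symm)
open KernelReflection (tadpole_smul)
open AxialDressing (l1_sub_le_of_blk_eq)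
open OneStepResolventKernel (Fib)
open OneStepKernelFamily (colH)
open SecondOrderResponse (vertexOfM mixOfK LocStencilFM vertexFamily_vertexOfM)
open BalabanStepW2 (vertexFamily_mono')
open AffineAveraging (Site box)
open AveragingContours (blk)
open Summit.QuantumFields.BalabanUV.Beta.TameKernelCalculus (Spr Loc trK trK_apply trK_comp trK_add Loc.comp Loc.add Loc.sub Spr.tame decays_of_le tadpole_add)
open Summit.QuantumFields.BalabanUV.Beta.BorderedHessian (sgnF sgnK sgnK_apply comp_sgnK diagK diagK_apply)
open Summit.QuantumFields.BalabanUV.Beta.BubbleParity (sgnK_neg)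
open Summit.QuantumFields.BalabanUV.Beta.KernelWardRemainderParity (sgnK_add trK_vertexOfM_eq_neg_sgnK_of_rows)
open Summit.QuantumFields.BalabanUV.Beta.SpineRecursiveParity (parityOdd_smul)
open Summit.QuantumFields.BalabanUV.Beta.KernelWardRelativeEnd (tadpole_eq_zero_of_parity)
open Summit.QuantumFields.BalabanUV.Beta.KernelWardRelative (tadpole_sub)
open Summit.QuantumFields.BalabanUV.Beta.ChartConjugation (conjV)
open Summit.QuantumFields.BalabanUV.Beta.SecondOrderRemainderTables (tadpole_mixOfK_eq_zero loc_mixOfK)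
open Summit.QuantumFields.BalabanUV.Beta.AveragingWardRootedStencils (legSite)
open Summit.QuantumFields.BalabanUV.Beta.CompositeCorrectorLocality (blockSitesF)
open Summit.QuantumFields.BalabanUV.Beta.SymCorrectorFace (faceWt faceWtSum faceWtSum_nonneg abs_faceWt_le)
open Summit.QuantumFields.BalabanUV.Beta.SymCorrectorW2Gauge (loc_faceGen)

variable {d : ℕ}

/-! ## §1 The anticommutator of a diagonal kernel with a parity-odd kernel is parity-odd, hence tadpole-null -/

/-- [folklore] `diagK g` is symmetric and fixed by the sign conjugation (entrywise; a diagonal's mixed blocks vanish). -/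
theorem trK_diagK_eq_and_sgnK (g : (Fin (d + 1) → ℤ) → Fib d → ℝ) : trK (diagK g) = diagK g ∧ sgnK (diagK g) = diagK g := by
  constructor
  · funext x y a b
    rw [trK_apply, diagK_apply, diagK_apply]
    by_cases h : x = y ∧ a = b
    · obtain ⟨rfl, rfl⟩ := h
      simp
    · rw [if_neg h, if_neg (fun h' => h ⟨h'.1.symm, h'.2.symm⟩)]
  · funext x y a b
    rw [sgnK_apply, diagK_apply]
    by_cases h : x = y ∧ a = b
    · obtain ⟨rfl, rfl⟩ := h
      rw [if_pos ⟨rfl, rfl⟩]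
      rcases a with α | m <;> simp [BorderedHessian.sgnF]
    · rw [if_neg h, mul_zero]

/-- [folklore] **THE ANTICOMMUTATOR `{diagK g, V}` OF A DIAGONAL KERNEL WITH A PARITY-ODD KERNEL IS PARITY-ODD**:
`trK V = −sgnK V ⟹ trK (diagK g∘V + V∘diagK g) = −sgnK (diagK g∘V + V∘diagK g)` (`trK_comp`, `comp_sgnK`, the diagonal being symmetric and sign-fixed). -/
theorem parityOdd_anticomm_diagK (g : (Fin (d + 1) → ℤ) → Fib d → ℝ) {V : MKer (d + 1) (Fib d)} (hV : trK V = -sgnK V) :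
    trK (comp (diagK g) V + comp V (diagK g)) = -sgnK (comp (diagK g) V + comp V (diagK g)) := by
  obtain ⟨ht, hs⟩ := trK_diagK_eq_and_sgnK g
  rw [trK_add, trK_comp, trK_comp, ht, hV, sgnK_add, ← comp_sgnK, ← comp_sgnK, hs,
    TameKernelCalculus.comp_neg_left, TameKernelCalculus.comp_neg_right]
  abel

/-- [folklore] **… HENCE TADPOLE-NULL** against every spread sgn-symmetric `G` (`tadpole_eq_zero_of_parity`; `diagK g` and `V` localised). -/
theorem tadpole_anticomm_diagK_eq_zero {G : MKer (d + 1) (Fib d)} (hG : Spr G) (hGt : trK G = sgnK G) {g : (Fin (d + 1) → ℤ) → Fib d → ℝ}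
    (hD : Loc (diagK g)) {V : MKer (d + 1) (Fib d)} (hV : Loc V) (hVp : trK V = -sgnK V) :
    tadpole G (comp (diagK g) V + comp V (diagK g)) = 0 :=
  tadpole_eq_zero_of_parity hG hGt ((hD.comp hV).add (hV.comp hD)) (parityOdd_anticomm_diagK g hVp)

/-- [folklore] **UNDER THE TADPOLE A LEFT MULTIPLICATION IS HALF A COMMUTATOR**: `tadpole G (diagK g∘V) = −½·tadpole G (conjV V (diagK g))`
(`conjV V D = V∘D − D∘V`; the anticommutator drops). -/
theorem tadpole_comp_diagK_left_eq {G : MKer (d + 1) (Fib d)} (hG : Spr G) (hGt : trK G = sgnK G) {g : (Fin (d + 1) → ℤ) → Fib d → ℝ}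
    (hD : Loc (diagK g)) {V : MKer (d + 1) (Fib d)} (hV : Loc V) (hVp : trK V = -sgnK V) :
    tadpole G (comp (diagK g) V) = -(1 / 2 : ℝ) * tadpole G (conjV V (diagK g)) := by
  have h0 := tadpole_anticomm_diagK_eq_zero hG hGt hD hV hVp
  rw [tadpole_add hG (hD.comp hV) (hV.comp hD)] at h0
  rw [show conjV V (diagK g) = comp V (diagK g) - comp (diagK g) V from rfl, tadpole_sub hG (hV.comp hD) (hD.comp hV)]
  linarith

/-! ## §2 The LEFT word of the site-law mixed transport under the tadpole -/

section Left

variable {n : ℕ} (hn : 0 < n) {G : MKer (d + 1) (Fib d)} (hG : Spr G) (hGt : trK G = sgnK G) {K : MKer (d + 1) (Fib d)} (hK : Spr K)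
  {M : Fin (d + 1) → Site (d + 1) → MKer (d + 1) (Fib d)} {CM δM : ℝ} (hMv : VertexFamily M n CM δM) (hδM : 0 < δM)
  (hMp : ∀ ρ w, trK (M ρ w) = -sgnK (M ρ w)) (ϱ : Site (d + 1)) (r : Fin (d + 1) → ℕ) (ξ' : ℝ)
include hn hG hGt hK hMv hδM hMp

omit hG hGt hMp in
/-- [folklore] The multiplier vertex `vertexOfM K n M ν y′` of a localised multiplier table through a spread kernel is localised (`vertexFamily_vertexOfM` at the common rate). -/
theorem loc_vertexOfM_of_spr (ν : Fin (d + 1)) (y' : Site (d + 1)) : Loc (vertexOfM K n M ν y') := by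
  haveI : NeZero n := ⟨hn.ne'⟩
  obtain ⟨C, δK, hδK, hKd⟩ := hK
  have hm : 0 < min δK δM := lt_min hδK hδM
  have hKm : Decays K |C| (min δK δM) := decays_of_le hKd (min_le_left _ _)
  have hCM : 0 ≤ CM := (hMv 0 0).nonneg (Sum.inl 0)
  have hMm : VertexFamily M n CM (min δK δM) := vertexFamily_mono' hMv hCM (min_le_right _ _)
  have hV := vertexFamily_vertexOfM (N := n) hKm (abs_nonneg C) hMm hm le_rfl
  exact ⟨_, _, _, _, half_pos hm, hV ν y'⟩

/-- [folklore] **THE LEFT WORD IS HALF A COMMUTATOR UNDER THE TADPOLE**: with `Θ′ μ y` the face symbol of `K` (scalar `ξ′`) and `V_M := vertexOfM K n M`,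
`tadpole G (Θ′ μ y∘V_M ν y′) = −½·tadpole G (conjV (V_M ν y′) (Θ′ μ y))` for row-parity-odd `M` (`trK_vertexOfM_eq_neg_sgnK_of_rows`). -/
theorem tadpole_leftWord_eq (μ : Fin (d + 1)) (y : Site (d + 1)) (ν : Fin (d + 1)) (y' : Site (d + 1)) :
    tadpole G (comp (diagK fun z b => ∑ α : Fin (d + 1), ∑ x ∈ blockSitesF n (blk n (legSite ϱ z b)), colH K n μ y α x * (ξ' * faceWt r n α x))
        (vertexOfM K n M ν y'))
      = -(1 / 2 : ℝ) * tadpole G (conjV (vertexOfM K n M ν y')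
          (diagK fun z b => ∑ α : Fin (d + 1), ∑ x ∈ blockSitesF n (blk n (legSite ϱ z b)), colH K n μ y α x * (ξ' * faceWt r n α x))) :=
  tadpole_comp_diagK_left_eq hG hGt (loc_faceGen hn hK ϱ r ξ' μ y) (loc_vertexOfM_of_spr hn hK hMv hδM ν y')
    (trK_vertexOfM_eq_neg_sgnK_of_rows K hMp ν y')

end Left

/-! ## §3 The ANCHOR word is localised and tadpole-null -/

section Anchor

variable {n : ℕ}

/-- [folklore] **THE ANCHOR FAMILY IS A LOCAL FIELD–MULTIPLIER TABLE**: for a multiplier table bi-localised at the coarse points (`VertexFamily M n CM δM`), the block-local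
rescaling `A κ u ρ w := (if blk n (n•w + ϱ) = blk n u then ξ′·faceWt r n κ u else 0) • M ρ w` is `LocStencilFM n A (|ξ′|·faceWtSum r n·CM·e^{3δM((d+1)n + |ϱ|₁)}) δM`
(same block ⇒ `|u − n•w|₁ ≤ (d+1)n + |ϱ|₁`; two triangle inequalities). -/
theorem locStencilFM_anchor (hn : 1 ≤ n) {M : Fin (d + 1) → Site (d + 1) → MKer (d + 1) (Fib d)} {CM δM : ℝ} (hMv : VertexFamily M n CM δM) (hδM : 0 ≤ δM)
    (ϱ : Site (d + 1)) (r : Fin (d + 1) → ℕ) (ξ' : ℝ) :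
    LocStencilFM n (fun κ u ρ w => (if blk n ((n : ℤ) • w + ϱ) = blk n u then ξ' * faceWt r n κ u else 0) • M ρ w)
      (|ξ'| * faceWtSum r n * CM * Real.exp (3 * δM * (((d : ℝ) + 1) * n + l1 ϱ))) δM := by
  have hCM : 0 ≤ CM := (hMv 0 0).nonneg (Sum.inl 0)
  have hn0 : 0 < n := hn
  intro κ u ρ w x z a b
  dsimp only
  set R : ℝ := ((d : ℝ) + 1) * n + l1 ϱ with hR
  have hR0 : 0 ≤ R := by have := l1_nonneg ϱ; positivity
  have hpos : 0 ≤ |ξ'| * faceWtSum r n * CM * Real.exp (3 * δM * R) * Real.exp (-δM * l1 (u - (n : ℤ) • w))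
      * Real.exp (-δM * (l1 (x - u) + l1 (z - u))) := by
    have := faceWtSum_nonneg r n; positivity
  by_cases h : blk n ((n : ℤ) • w + ϱ) = blk n u
  · rw [if_pos h, Pi.smul_apply, Pi.smul_apply, Pi.smul_apply, Pi.smul_apply, smul_eq_mul, abs_mul, abs_mul]
    -- the distance from `u` to the coarse point `n•w`
    have hD : l1 (u - (n : ℤ) • w) ≤ R := by
      have h1 : l1 (u - ((n : ℤ) • w + ϱ)) ≤ ((d : ℝ) + 1) * n := l1_sub_le_of_blk_eq hn h
      have h2 : l1 (u - (n : ℤ) • w) ≤ l1 (u - ((n : ℤ) • w + ϱ)) + l1 (((n : ℤ) • w + ϱ) - (n : ℤ) • w) := l1_sub_triangle _ _ _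
      have h3 : ((n : ℤ) • w + ϱ) - (n : ℤ) • w = ϱ := by abel
      rw [h3] at h2
      linarith
    have hM := hMv ρ w x z a b
    have tx : l1 (x - u) ≤ l1 (x - (n : ℤ) • w) + l1 ((n : ℤ) • w - u) := l1_sub_triangle _ _ _
    have tz : l1 (z - u) ≤ l1 (z - (n : ℤ) • w) + l1 ((n : ℤ) • w - u) := l1_sub_triangle _ _ _
    rw [l1_sub_symm ((n : ℤ) • w) u] at tx tz
    have hξ : |ξ'| * |faceWt r n κ u| ≤ |ξ'| * faceWtSum r n := mul_le_mul_of_nonneg_left (abs_faceWt_le hn0 r κ u) (abs_nonneg _)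
    have hE : CM * Real.exp (-δM * (l1 (x - (n : ℤ) • w) + l1 (z - (n : ℤ) • w)))
        ≤ CM * Real.exp (3 * δM * R) * Real.exp (-δM * l1 (u - (n : ℤ) • w)) * Real.exp (-δM * (l1 (x - u) + l1 (z - u))) := by
      rw [mul_assoc, mul_assoc, ← Real.exp_add, ← Real.exp_add]
      refine mul_le_mul_of_nonneg_left (Real.exp_le_exp.2 ?_) hCM
      nlinarith [l1_nonneg (x - u), l1_nonneg (z - u), l1_nonneg (u - (n : ℤ) • w), l1_nonneg (x - (n : ℤ) • w), l1_nonneg (z - (n : ℤ) • w)]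
    have hfw : 0 ≤ |ξ'| * faceWtSum r n := mul_nonneg (abs_nonneg _) (faceWtSum_nonneg r n)
    calc |ξ'| * |faceWt r n κ u| * |M ρ w x z a b|
        ≤ (|ξ'| * faceWtSum r n) * (CM * Real.exp (-δM * (l1 (x - (n : ℤ) • w) + l1 (z - (n : ℤ) • w)))) :=
          mul_le_mul hξ hM (abs_nonneg _) hfw
      _ ≤ (|ξ'| * faceWtSum r n) * (CM * Real.exp (3 * δM * R) * Real.exp (-δM * l1 (u - (n : ℤ) • w)) * Real.exp (-δM * (l1 (x - u) + l1 (z - u)))) :=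
          mul_le_mul_of_nonneg_left hE hfw
      _ = |ξ'| * faceWtSum r n * CM * Real.exp (3 * δM * R) * Real.exp (-δM * l1 (u - (n : ℤ) • w)) * Real.exp (-δM * (l1 (x - u) + l1 (z - u))) := by
          ring
  · rw [if_neg h, zero_smul, Pi.zero_apply, Pi.zero_apply, Pi.zero_apply, Pi.zero_apply, abs_zero]
    exact hpos

/-- [folklore] **THE ANCHOR WORD IS TADPOLE-NULL** against every spread sgn-symmetric `G`: `tadpole G (mixOfK K n A μ y ν y′) = 0` for a spread weight kernel `K`, a coarse-localised
row-parity-odd multiplier table `M` (leaf-05's `tadpole_mixOfK_eq_zero` + §3's class + `parityOdd_smul`). -/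
theorem tadpole_anchor_eq_zero [NeZero n] {G : MKer (d + 1) (Fib d)} (hG : Spr G) (hGt : trK G = sgnK G) {K : MKer (d + 1) (Fib d)} (hK : Spr K)
    {M : Fin (d + 1) → Site (d + 1) → MKer (d + 1) (Fib d)} {CM δM : ℝ} (hMv : VertexFamily M n CM δM) (hδM : 0 < δM)
    (hMp : ∀ ρ w, trK (M ρ w) = -sgnK (M ρ w)) (ϱ : Site (d + 1)) (r : Fin (d + 1) → ℕ) (ξ' : ℝ)
    (μ : Fin (d + 1)) (y : Site (d + 1)) (ν : Fin (d + 1)) (y' : Site (d + 1)) :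
    tadpole G (mixOfK K n (fun κ u ρ w => (if blk n ((n : ℤ) • w + ϱ) = blk n u then ξ' * faceWt r n κ u else 0) • M ρ w) μ y ν y') = 0 := by
  have hn : 1 ≤ n := Nat.one_le_iff_ne_zero.2 (NeZero.ne n)
  obtain ⟨C, δK, hδK, hKd⟩ := hK
  have hm : 0 < min δK δM := lt_min hδK hδM
  have hKm : Decays K |C| (min δK δM) := decays_of_le hKd (min_le_left _ _)
  have hA := (locStencilFM_anchor hn hMv hδM.le ϱ r ξ').mono (min_le_right δK δM)
  exact tadpole_mixOfK_eq_zero hG hGt hKm (abs_nonneg C) hm hA (fun κ u ρ w => parityOdd_smul _ (hMp ρ w)) μ y ν y'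

end Anchor

/-! ## §4 The displayed mixed word of TT20 under the tadpole: half of TT13's commutator word -/

section Word

variable {n : ℕ} [NeZero n] (hn : 0 < n) {G : MKer (d + 1) (Fib d)} (hG : Spr G) (hGt : trK G = sgnK G) {K : MKer (d + 1) (Fib d)} (hK : Spr K)
  {M : Fin (d + 1) → Site (d + 1) → MKer (d + 1) (Fib d)} {CM δM : ℝ} (hMv : VertexFamily M n CM δM) (hδM : 0 < δM)
  (hMp : ∀ ρ w, trK (M ρ w) = -sgnK (M ρ w)) (ϱ : Site (d + 1)) (r : Fin (d + 1) → ℕ) (ξ' : ℝ)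
include hn hG hGt hK hMv hδM hMp

/-- [folklore] **`tadpole G (WMs μ y ν y′) = ½·tadpole G (conjV (V_M ν y′) (Θ′ μ y) + conjV (V_M μ y) (Θ′ ν y′))`** — the displayed mixed word of TT20
`SymCorrectorW2SiteGauge` (`WMs := (mixOfK K n A μ y ν y′ + mixOfK K n A ν y′ μ y) − (Θ′ μ y∘V_M ν y′ + Θ′ ν y′∘V_M μ y)`) has, against every spread sgn-symmetric `G`, the
tadpole of HALF of TT13's commutator word at scalar `ξ′`: the anchor words drop (§3), the left words are half commutators (§2). -/
theorem tadpole_WMs_eq (μ : Fin (d + 1)) (y : Site (d + 1)) (ν : Fin (d + 1)) (y' : Site (d + 1)) :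
    tadpole G
        ((mixOfK K n (fun κ u ρ w => (if blk n ((n : ℤ) • w + ϱ) = blk n u then ξ' * faceWt r n κ u else 0) • M ρ w) μ y ν y'
            + mixOfK K n (fun κ u ρ w => (if blk n ((n : ℤ) • w + ϱ) = blk n u then ξ' * faceWt r n κ u else 0) • M ρ w) ν y' μ y)
          - (comp (diagK fun z b => ∑ α : Fin (d + 1), ∑ x ∈ blockSitesF n (blk n (legSite ϱ z b)), colH K n μ y α x * (ξ' * faceWt r n α x)) (vertexOfM K n M ν y')
            + comp (diagK fun z b => ∑ α : Fin (d + 1), ∑ x ∈ blockSitesF n (blk n (legSite ϱ z b)), colH K n ν y' α x * (ξ' * faceWt r n α x)) (vertexOfM K n M μ y)))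
      = (1 / 2 : ℝ) * tadpole G
          (conjV (vertexOfM K n M ν y') (diagK fun z b => ∑ α : Fin (d + 1), ∑ x ∈ blockSitesF n (blk n (legSite ϱ z b)), colH K n μ y α x * (ξ' * faceWt r n α x))
            + conjV (vertexOfM K n M μ y) (diagK fun z b => ∑ α : Fin (d + 1), ∑ x ∈ blockSitesF n (blk n (legSite ϱ z b)), colH K n ν y' α x * (ξ' * faceWt r n α x))) := by
  have hn1 : 1 ≤ n := hn
  have locC : ∀ {V D : MKer (d + 1) (Fib d)}, Loc V → Loc D → Loc (conjV V D) := fun hV hD => (hV.comp hD).sub (hD.comp hV)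
  -- localisations
  have hD1 := loc_faceGen hn hK ϱ r ξ' μ y
  have hD2 := loc_faceGen hn hK ϱ r ξ' ν y'
  have hV1 := loc_vertexOfM_of_spr hn hK hMv hδM ν y'
  have hV2 := loc_vertexOfM_of_spr hn hK hMv hδM μ y
  have hA1 : Loc (mixOfK K n (fun κ u ρ w => (if blk n ((n : ℤ) • w + ϱ) = blk n u then ξ' * faceWt r n κ u else 0) • M ρ w) μ y ν y') := by
    obtain ⟨C, δK, hδK, hKd⟩ := hK
    have hm : 0 < min δK δM := lt_min hδK hδM
    exact loc_mixOfK (decays_of_le hKd (min_le_left _ _)) (abs_nonneg C) hm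
      ((locStencilFM_anchor hn1 hMv hδM.le ϱ r ξ').mono (min_le_right δK δM)) μ y ν y'
  have hA2 : Loc (mixOfK K n (fun κ u ρ w => (if blk n ((n : ℤ) • w + ϱ) = blk n u then ξ' * faceWt r n κ u else 0) • M ρ w) ν y' μ y) := by
    obtain ⟨C, δK, hδK, hKd⟩ := hK
    have hm : 0 < min δK δM := lt_min hδK hδM
    exact loc_mixOfK (decays_of_le hKd (min_le_left _ _)) (abs_nonneg C) hm
      ((locStencilFM_anchor hn1 hMv hδM.le ϱ r ξ').mono (min_le_right δK δM)) ν y' μ y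
  have zA1 := tadpole_anchor_eq_zero hG hGt hK hMv hδM hMp ϱ r ξ' μ y ν y'
  have zA2 := tadpole_anchor_eq_zero hG hGt hK hMv hδM hMp ϱ r ξ' ν y' μ y
  have eL1 := tadpole_leftWord_eq hn hG hGt hK hMv hδM hMp ϱ r ξ' μ y ν y'
  have eL2 := tadpole_leftWord_eq hn hG hGt hK hMv hδM hMp ϱ r ξ' ν y' μ y
  rw [tadpole_sub hG (hA1.add hA2) ((hD1.comp hV1).add (hD2.comp hV2)), tadpole_add hG hA1 hA2, tadpole_add hG (hD1.comp hV1) (hD2.comp hV2),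
    zA1, zA2, eL1, eL2, tadpole_add hG (locC hV1 hD1) (locC hV2 hD2)]
  ring

end Word

end Summit.QuantumFields.BalabanUV.Beta.SymCorrectorMixedSiteNull

end
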